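import Literature.Probability.LatticeModels.GHSTruncatedVolumeMonotonicity
import Summits.CriticalPhenomena.PercolationContinuityZ3.Theorems.FK.IsingPositiveFieldCLT
import Literature.Probability.LatticeModels.MeanFieldLowerBound
import Mathlib.Analysis.Normed.Group.Tannery
import HarnessLib

/-!
# THE FINITE-VOLUME PLUS SUSCEPTIBILITIES INCREASE TO `σ²(β,h) = Σ_z ⟨σ_0;σ_z⟩⁺_{β,h}`, AND `h ↦ ⟨σ_x;σ_y⟩⁺_{β,h}`
# IS NONINCREASING AND RIGHT-CONTINUOUS ON `[0, ∞)` (Ellis 2006, Lemma V.7.3 (a), (b), (c))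

Claimed R42 (8)(c) in the cell INBOX at 2026-08-28T21:27:52Z by fkp-10a gen 356 (NEW CLAIM #1 of the gen), addressed to coordinator fk-4 (next seated gen; (ι) in force for windows); lineage row FO-10a-g356 (self-suggested), package g356-susceptibility, label FR-C.
Helper file of the `fk-continuity` build cell (bschramm lane; `--supports stmt-CriticalPhenomena-4575`); builds on
p205010 (kernel theorem, internal audit signed; external expert review pending). No definitions, no named facts, no
sorries; standard axioms. UNCONDITIONAL (nearest-neighbour Ising model on `ℤ^d`, every `d`).

Notation (no definitions are introduced; everything is written out): the finite-volume plus truncated two-point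
function of the box `Λ_L = box d L`, `u_L(x,y;h) = ⟨σ_{{x}∆{y}}⟩⁺_{Λ_L;β,h} − ⟨σ_x⟩⁺_{Λ_L;β,h}⟨σ_y⟩⁺_{Λ_L;β,h}`, its
infinite-volume counterpart `u(x,y;h) = ⟨σ_{{x}∆{y}}⟩⁺_{β,h} − ⟨σ_x⟩⁺_{β,h}⟨σ_y⟩⁺_{β,h}` (`plusCorr`), the
finite-volume susceptibility `χ_L(h) = Σ_{y∈Λ_L} u_L(0,y;h)` and `σ²(β,h) = Σ'_z u(0,z;h)`.

* `isingCorrTrunc_plus_box_mono` — **Ellis V.7.3 (a)**: `L ≤ L' ⇒ u_L(x,y;h) ≤ u_{L'}(x,y;h)` (`β > 0`, `h ≥ 0`; GHS in the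
  volume — the tree's Literature theorem `isingTrunc_plus_mono_volume` of `GHSTruncatedVolumeMonotonicity`, Lebowitz 1974),
  `tendsto_isingCorrTrunc_plus_box` (`u_L → u`),
  `isingCorrTrunc_plus_box_le_plusTruncated` (`u_L ≤ u`), `plusTruncated_nonneg` (`u ≥ 0`, FKG).
* `plusTruncated_antitoneOn_field` — **Ellis V.7.3 (b), eq. (5.27)**: `h ↦ u(x,y;h)` is nonincreasing on `[0,∞)` (GHS);
  `plusTruncated_continuousWithinAt_Ici_field` — **Ellis V.7.3 (c)**: it is right-continuous at every `h₀ ≥ 0`.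
* `hasDerivAt_isingCorr_plus_box_singleton_field` — `d/dh ⟨σ_0⟩⁺_{Λ_L;β,h} = β χ_L(h)` (Friedli–Velenik Lemma 3.31).
* `sum_isingCorrTrunc_plus_box_mono`, `sum_isingCorrTrunc_plus_box_le_tsum`, **`tendsto_sum_isingCorrTrunc_plus_box`** —
  `χ_L(h) ↑ σ²(β,h)` when `σ²(β,h) < ∞` (monotone convergence), `tendsto_sum_isingCorrTrunc_plus_box_atTop` — `χ_L(h) → ∞`
  otherwise ("`0 < Σ_{k∈Λ}⟨Y_0;Y_k⟩_{Λ,β,h,+} ↑ Σ_k ⟨Y_0;Y_k⟩_{β,h} ≤ ∞`").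
* `tendsto_tsum_plusTruncated_nhdsWithin_Ici` — **`σ²(β,·)` is right-continuous** at every `h₀ ≥ 0` with `σ²(β,h₀) < ∞`
  (dominated convergence), `tendsto_tsum_plusTruncated_atTop_of_not_summable` — and `σ²(β,h) → ∞` as `h ↓ h₀` when
  `σ²(β,h₀) = ∞` (`β > 0`).

## References

* R. S. Ellis, *Entropy, Large Deviations, and Statistical Mechanics*, Springer (1985/2006), Lemma V.7.3,
  pp. 203–204. [Ellis2006]
* A. D. Sokal, J. Stat. Phys. 25 (1981) 25–50, Appendix. [SokalMoreInequalities1981]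
* S. Friedli, Y. Velenik, *Statistical Mechanics of Lattice Systems*, CUP (2017), Lemma 3.31, Thm. 3.17,
  Exercise 3.16. [FriedliVelenik2017]
-/

noncomputable section

namespace Summit.CriticalPhenomena.PercolationContinuityZ3.Theorems.FK

namespace IsingSusceptibility

open MeasureTheory Filter Topology Finset Set
open scoped symmDiff
open Literature.Probability.LatticeModels
open Summit.CriticalPhenomena.PercolationContinuityZ3.Theorems.FK.IsingCLT

variable {d : ℕ}

/-! ### Volume monotonicity and the infinite-volume limit of `u_L(x,y;h)` -/

/-- **Ellis V.7.3 (a) along boxes**: for `β > 0`, `h ≥ 0`, `L ≤ L'` and `x, y ∈ Λ_L`, `u_L(x,y;h) ≤ u_{L'}(x,y;h)`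
(the tree's `Literature.Probability.LatticeModels.isingTrunc_plus_mono_volume` in set notation along boxes).
[cite: Ellis2006, Lemma V.7.3 (a); Lebowitz1974, §2, Remark (ii)] -/
theorem isingCorrTrunc_plus_box_mono {β h : ℝ} (hβ : 0 < β) (hh : 0 ≤ h) {L L' : ℕ} (hL : L ≤ L') {x y : Site d}
    (hx : x ∈ box d L) (hy : y ∈ box d L) :
    isingCorr (zdGraph d) (box d L) β h .plus ({x} ∆ {y}) -
        isingCorr (zdGraph d) (box d L) β h .plus {x} * isingCorr (zdGraph d) (box d L) β h .plus {y} ≤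
      isingCorr (zdGraph d) (box d L') β h .plus ({x} ∆ {y}) -
        isingCorr (zdGraph d) (box d L') β h .plus {x} * isingCorr (zdGraph d) (box d L') β h .plus {y} := by
  classical
  have := Literature.Probability.LatticeModels.isingTrunc_plus_mono_volume (zdGraph d) hβ.le hh (box_mono d hL) hx hy
  simpa only [isingTrunc_eq_isingCorr] using this

/-- `u_L(x,y;h) → u(x,y;h)` as `L → ∞` (`β ≥ 0`, every `h`). [cite: FriedliVelenik2017, Thm. 3.17] -/
theorem tendsto_isingCorrTrunc_plus_box {β : ℝ} (hβ : 0 ≤ β) (h : ℝ) (x y : Site d) :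
    Tendsto (fun L : ℕ => isingCorr (zdGraph d) (box d L) β h .plus ({x} ∆ {y}) -
        isingCorr (zdGraph d) (box d L) β h .plus {x} * isingCorr (zdGraph d) (box d L) β h .plus {y}) atTop
      (𝓝 (plusCorr d β h ({x} ∆ {y}) - plusCorr d β h {x} * plusCorr d β h {y})) :=
  (tendsto_isingCorr_plus_box hβ h _).sub ((tendsto_isingCorr_plus_box hβ h _).mul (tendsto_isingCorr_plus_box hβ h _))

/-- `u_L(x,y;h) ≥ 0` in every box (FKG). [cite: FriedliVelenik2017, Thm. 3.21] -/
theorem isingCorrTrunc_plus_box_nonneg {β : ℝ} (hβ : 0 ≤ β) (h : ℝ) (L : ℕ) (x y : Site d) :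
    0 ≤ isingCorr (zdGraph d) (box d L) β h .plus ({x} ∆ {y}) -
        isingCorr (zdGraph d) (box d L) β h .plus {x} * isingCorr (zdGraph d) (box d L) β h .plus {y} := by
  classical
  have := isingExpect_spinAt_mul_sub_nonneg (zdGraph d) (box d L) hβ h .plus x y
  simpa only [isingTrunc_eq_isingCorr] using this

/-- **`u(x,y;h) ≥ 0`** (`β ≥ 0`, every `h`): the plus-state truncated two-point function is nonnegative (FKG in the
limit; Ellis: "non-negative (Percus inequality)"). [cite: Ellis2006, Lemma V.7.3 (b)] -/
theorem plusTruncated_nonneg {β : ℝ} (hβ : 0 ≤ β) (h : ℝ) (x y : Site d) :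
    0 ≤ plusCorr d β h ({x} ∆ {y}) - plusCorr d β h {x} * plusCorr d β h {y} :=
  ge_of_tendsto' (tendsto_isingCorrTrunc_plus_box hβ h x y) fun L => isingCorrTrunc_plus_box_nonneg hβ h L x y

/-- **`u_L(x,y;h) ≤ u(x,y;h)`** for `x, y ∈ Λ_L` (`β > 0`, `h ≥ 0`): the boxes increase to the plus state ("increases to
`⟨Y_0;Y_k⟩_{β,h}`"). [cite: Ellis2006, Lemma V.7.3 (a)] -/
theorem isingCorrTrunc_plus_box_le_plusTruncated {β h : ℝ} (hβ : 0 < β) (hh : 0 ≤ h) {L : ℕ} {x y : Site d}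
    (hx : x ∈ box d L) (hy : y ∈ box d L) :
    isingCorr (zdGraph d) (box d L) β h .plus ({x} ∆ {y}) -
        isingCorr (zdGraph d) (box d L) β h .plus {x} * isingCorr (zdGraph d) (box d L) β h .plus {y} ≤
      plusCorr d β h ({x} ∆ {y}) - plusCorr d β h {x} * plusCorr d β h {y} :=
  ge_of_tendsto (tendsto_isingCorrTrunc_plus_box hβ.le h x y)
    (eventually_atTop.2 ⟨L, fun _ hL' => isingCorrTrunc_plus_box_mono hβ hh hL' hx hy⟩)

/-! ### Ellis V.7.3 (b), (c): monotonicity and right-continuity in the field -/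

/-- **ELLIS 2006, LEMMA V.7.3 (b), eq. (5.27)**: `h ↦ ⟨σ_{{x}∆{y}}⟩⁺_{β,h} − ⟨σ_x⟩⁺_{β,h}⟨σ_y⟩⁺_{β,h}` is nonincreasing
on `[0, ∞)` (`β ≥ 0`; GHS in finite volume, `antitoneOn_isingTrunc_field`, passed to the limit).
[cite: Ellis2006, Lemma V.7.3 (b), eq. (5.27); Lebowitz1974, Remark (ii)] -/
theorem plusTruncated_antitoneOn_field {β : ℝ} (hβ : 0 ≤ β) (x y : Site d) :
    AntitoneOn (fun h => plusCorr d β h ({x} ∆ {y}) - plusCorr d β h {x} * plusCorr d β h {y}) (Ici 0) := by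
  classical
  intro a ha b hb hab
  obtain ⟨L₀, hL₀⟩ := exists_forall_subset_box d ({x, y} : Finset (Site d))
  refine le_of_tendsto_of_tendsto (tendsto_isingCorrTrunc_plus_box hβ b x y) (tendsto_isingCorrTrunc_plus_box hβ a x y)
    (eventually_atTop.2 ⟨L₀, fun L hL => ?_⟩)
  have hx : x ∈ box d L := hL₀ L hL (by simp)
  have hy : y ∈ box d L := hL₀ L hL (by simp)
  have := antitoneOn_isingTrunc_field (zdGraph d) (Λ := box d L) hβ (Or.inr rfl) hx hy ha hb hab
  simpa only [isingTrunc_eq_isingCorr] using this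

/-- **ELLIS 2006, LEMMA V.7.3 (c)**: `h ↦ ⟨σ_{{x}∆{y}}⟩⁺_{β,h} − ⟨σ_x⟩⁺_{β,h}⟨σ_y⟩⁺_{β,h}` is right-continuous at every
`h₀ ≥ 0` (`β ≥ 0`), by the right-continuity of the plus state in the field (`plusCorr_continuousWithinAt_Ici_field`,
Friedli–Velenik Lemma 3.31 (1)). [cite: Ellis2006, Lemma V.7.3 (c); FriedliVelenik2017, Lemma 3.31 (1)] -/
theorem plusTruncated_continuousWithinAt_Ici_field {β : ℝ} (hβ : 0 ≤ β) (x y : Site d) {h₀ : ℝ} (hh₀ : 0 ≤ h₀) :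
    ContinuousWithinAt (fun h => plusCorr d β h ({x} ∆ {y}) - plusCorr d β h {x} * plusCorr d β h {y}) (Ici h₀) h₀ :=
  (plusCorr_continuousWithinAt_Ici_field hβ _ hh₀).sub
    ((plusCorr_continuousWithinAt_Ici_field hβ _ hh₀).mul (plusCorr_continuousWithinAt_Ici_field hβ _ hh₀))

/-! ### The finite-volume susceptibility `χ_L(h) = Σ_{y∈Λ_L} u_L(0,y;h) = β⁻¹ d/dh ⟨σ_0⟩⁺_{Λ_L;β,h}` -/

/-- **`d/dh ⟨σ_0⟩⁺_{Λ_L;β,h} = β Σ_{y∈Λ_L} u_L(0,y;h)`** (Friedli–Velenik 2017, Lemma 3.31 (1); Ellis (5.29):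
"`∂⟨Y_0⟩_{Λ,β,h,+}/∂h = β Σ_{k∈Λ} ⟨Y_0;Y_k⟩_{Λ,β,h,+}`"), in the tree's set notation.
[cite: FriedliVelenik2017, Lemma 3.31 (1); Ellis2006, eq. (5.29)] -/
theorem hasDerivAt_isingCorr_plus_box_singleton_field (β h : ℝ) (L : ℕ) :
    HasDerivAt (fun t => isingCorr (zdGraph d) (box d L) β t .plus {0})
      (β * ∑ y ∈ box d L, (isingCorr (zdGraph d) (box d L) β h .plus ({0} ∆ {y}) -
        isingCorr (zdGraph d) (box d L) β h .plus {0} * isingCorr (zdGraph d) (box d L) β h .plus {y})) h := by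
  classical
  have hfun : (fun t => isingCorr (zdGraph d) (box d L) β t .plus {0}) =
      fun t => isingExpect (zdGraph d) (box d L) β t .plus (spinAt 0) := by
    funext t; simp only [isingCorr, spinProduct_singleton]
  rw [hfun]
  have := hasDerivAt_isingExpect_spinAt_field (zdGraph d) (box d L) β h .plus (0 : Site d)
  simpa only [isingTrunc_eq_isingCorr] using this

/-- **`χ_L(h)` is nondecreasing in `L`** (`β > 0`, `h ≥ 0`): the terms increase with the volume (Ellis V.7.3 (a)) and the
new terms are nonnegative (FKG). [cite: Ellis2006, Lemma V.7.3 (a)] -/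
theorem sum_isingCorrTrunc_plus_box_mono {β h : ℝ} (hβ : 0 < β) (hh : 0 ≤ h) {L L' : ℕ} (hL : L ≤ L') :
    ∑ y ∈ box d L, (isingCorr (zdGraph d) (box d L) β h .plus ({0} ∆ {y}) -
        isingCorr (zdGraph d) (box d L) β h .plus {0} * isingCorr (zdGraph d) (box d L) β h .plus {y}) ≤
      ∑ y ∈ box d L', (isingCorr (zdGraph d) (box d L') β h .plus ({0} ∆ {y}) -
        isingCorr (zdGraph d) (box d L') β h .plus {0} * isingCorr (zdGraph d) (box d L') β h .plus {y}) :=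
  calc ∑ y ∈ box d L, (isingCorr (zdGraph d) (box d L) β h .plus ({0} ∆ {y}) -
          isingCorr (zdGraph d) (box d L) β h .plus {0} * isingCorr (zdGraph d) (box d L) β h .plus {y})
      ≤ ∑ y ∈ box d L, (isingCorr (zdGraph d) (box d L') β h .plus ({0} ∆ {y}) -
          isingCorr (zdGraph d) (box d L') β h .plus {0} * isingCorr (zdGraph d) (box d L') β h .plus {y}) :=
        Finset.sum_le_sum fun _ hy => isingCorrTrunc_plus_box_mono hβ hh hL (zero_mem_box d L) hy
    _ ≤ ∑ y ∈ box d L', (isingCorr (zdGraph d) (box d L') β h .plus ({0} ∆ {y}) -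
          isingCorr (zdGraph d) (box d L') β h .plus {0} * isingCorr (zdGraph d) (box d L') β h .plus {y}) :=
        Finset.sum_le_sum_of_subset_of_nonneg (box_mono d hL) fun y _ _ =>
          isingCorrTrunc_plus_box_nonneg hβ.le h L' 0 y

/-- **`χ_L(h) ≤ σ²(β,h)`** whenever `σ²(β,h) = Σ'_z u(0,z;h)` converges (`β > 0`, `h ≥ 0`). [cite: Ellis2006, Lemma V.7.3 (a)] -/
theorem sum_isingCorrTrunc_plus_box_le_tsum {β h : ℝ} (hβ : 0 < β) (hh : 0 ≤ h)
    (hs : Summable fun z : Site d => plusCorr d β h ({0} ∆ {z}) - plusCorr d β h {0} * plusCorr d β h {z}) (L : ℕ) :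
    ∑ y ∈ box d L, (isingCorr (zdGraph d) (box d L) β h .plus ({0} ∆ {y}) -
        isingCorr (zdGraph d) (box d L) β h .plus {0} * isingCorr (zdGraph d) (box d L) β h .plus {y}) ≤
      ∑' z : Site d, (plusCorr d β h ({0} ∆ {z}) - plusCorr d β h {0} * plusCorr d β h {z}) :=
  calc ∑ y ∈ box d L, (isingCorr (zdGraph d) (box d L) β h .plus ({0} ∆ {y}) -
          isingCorr (zdGraph d) (box d L) β h .plus {0} * isingCorr (zdGraph d) (box d L) β h .plus {y})
      ≤ ∑ y ∈ box d L, (plusCorr d β h ({0} ∆ {y}) - plusCorr d β h {0} * plusCorr d β h {y}) :=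
        Finset.sum_le_sum fun _ hy => isingCorrTrunc_plus_box_le_plusTruncated hβ hh (zero_mem_box d L) hy
    _ ≤ ∑' z : Site d, (plusCorr d β h ({0} ∆ {z}) - plusCorr d β h {0} * plusCorr d β h {z}) :=
        hs.sum_le_tsum _ fun z _ => plusTruncated_nonneg hβ.le h 0 z

/-- **ELLIS 2006, LEMMA V.7.3 (a) — THE FINITE-VOLUME SUSCEPTIBILITIES INCREASE TO `σ²(β,h)`** (monotone convergence):
for `β > 0`, `h ≥ 0` and `σ²(β,h) = Σ'_z (⟨σ_{{0}∆{z}}⟩⁺_{β,h} − ⟨σ_0⟩⁺_{β,h}⟨σ_z⟩⁺_{β,h}) < ∞`,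
`χ_L(h) = Σ_{y∈Λ_L} (⟨σ_{{0}∆{y}}⟩⁺_{Λ_L;β,h} − ⟨σ_0⟩⁺_{Λ_L}⟨σ_y⟩⁺_{Λ_L}) → σ²(β,h)` as `L → ∞`.
[cite: Ellis2006, Lemma V.7.3 (a); SokalMoreInequalities1981, Appendix] -/
theorem tendsto_sum_isingCorrTrunc_plus_box {β h : ℝ} (hβ : 0 < β) (hh : 0 ≤ h)
    (hs : Summable fun z : Site d => plusCorr d β h ({0} ∆ {z}) - plusCorr d β h {0} * plusCorr d β h {z}) :
    Tendsto (fun L : ℕ => ∑ y ∈ box d L, (isingCorr (zdGraph d) (box d L) β h .plus ({0} ∆ {y}) -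
        isingCorr (zdGraph d) (box d L) β h .plus {0} * isingCorr (zdGraph d) (box d L) β h .plus {y})) atTop
      (𝓝 (∑' z : Site d, (plusCorr d β h ({0} ∆ {z}) - plusCorr d β h {0} * plusCorr d β h {z}))) := by
  classical
  refine tendsto_order.2 ⟨fun a ha => ?_, fun a ha => Eventually.of_forall fun L =>
    (sum_isingCorrTrunc_plus_box_le_tsum hβ hh hs L).trans_lt ha⟩
  -- a finite set `F` carrying more than `a` of the sum, then boxes containing `F`
  obtain ⟨F, hF⟩ := ((hs.hasSum.eventually (lt_mem_nhds ha))).exists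
  obtain ⟨L₀, hL₀⟩ := exists_forall_subset_box d F
  have hlimF : Tendsto (fun L : ℕ => ∑ y ∈ F, (isingCorr (zdGraph d) (box d L) β h .plus ({0} ∆ {y}) -
      isingCorr (zdGraph d) (box d L) β h .plus {0} * isingCorr (zdGraph d) (box d L) β h .plus {y})) atTop
      (𝓝 (∑ y ∈ F, (plusCorr d β h ({0} ∆ {y}) - plusCorr d β h {0} * plusCorr d β h {y}))) :=
    tendsto_finsetSum _ fun y _ => tendsto_isingCorrTrunc_plus_box hβ.le h 0 y
  filter_upwards [(tendsto_order.1 hlimF).1 a hF, eventually_ge_atTop L₀] with L hL hLL₀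
  exact hL.trans_le (Finset.sum_le_sum_of_subset_of_nonneg (hL₀ L hLL₀) fun y _ _ =>
    isingCorrTrunc_plus_box_nonneg hβ.le h L 0 y)

/-- **`χ_L(h) → ∞` when `σ²(β,h) = ∞`** (`β ≥ 0`, every `h`; the divergent half of the monotone convergence).
[cite: Ellis2006, Lemma V.7.3 (a)] -/
theorem tendsto_sum_isingCorrTrunc_plus_box_atTop {β : ℝ} (hβ : 0 ≤ β) (h : ℝ)
    (hs : ¬ Summable fun z : Site d => plusCorr d β h ({0} ∆ {z}) - plusCorr d β h {0} * plusCorr d β h {z}) :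
    Tendsto (fun L : ℕ => ∑ y ∈ box d L, (isingCorr (zdGraph d) (box d L) β h .plus ({0} ∆ {y}) -
        isingCorr (zdGraph d) (box d L) β h .plus {0} * isingCorr (zdGraph d) (box d L) β h .plus {y})) atTop atTop := by
  classical
  refine tendsto_atTop.2 fun M => ?_
  -- the partial sums of a non-summable nonnegative family are unbounded
  have hbig : ∃ F : Finset (Site d), M + 1 ≤ ∑ y ∈ F, (plusCorr d β h ({0} ∆ {y}) - plusCorr d β h {0} * plusCorr d β h {y}) := by
    by_contra hcon
    refine hs (summable_of_sum_le (c := M + 1) (fun z => plusTruncated_nonneg hβ h 0 z) fun F => ?_)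
    by_contra hF
    exact hcon ⟨F, (not_le.1 hF).le⟩
  obtain ⟨F, hF⟩ := hbig
  obtain ⟨L₀, hL₀⟩ := exists_forall_subset_box d F
  have hlimF : Tendsto (fun L : ℕ => ∑ y ∈ F, (isingCorr (zdGraph d) (box d L) β h .plus ({0} ∆ {y}) -
      isingCorr (zdGraph d) (box d L) β h .plus {0} * isingCorr (zdGraph d) (box d L) β h .plus {y})) atTop
      (𝓝 (∑ y ∈ F, (plusCorr d β h ({0} ∆ {y}) - plusCorr d β h {0} * plusCorr d β h {y}))) :=
    tendsto_finsetSum _ fun y _ => tendsto_isingCorrTrunc_plus_box hβ h 0 y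
  have hM : M < ∑ y ∈ F, (plusCorr d β h ({0} ∆ {y}) - plusCorr d β h {0} * plusCorr d β h {y}) := by linarith
  filter_upwards [(tendsto_order.1 hlimF).1 M hM, eventually_ge_atTop L₀] with L hL hLL₀
  exact (hL.trans_le (Finset.sum_le_sum_of_subset_of_nonneg (hL₀ L hLL₀) fun y _ _ =>
    isingCorrTrunc_plus_box_nonneg hβ h L 0 y)).le

/-! ### Right-continuity of `σ²(β,·)` -/

/-- **`σ²(β,·)` IS RIGHT-CONTINUOUS WHERE FINITE**: for `β ≥ 0`, `h₀ ≥ 0` and `σ²(β,h₀) < ∞`,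
`Σ'_z u(0,z;h) → Σ'_z u(0,z;h₀)` as `h → h₀` within `[h₀, ∞)` (each term is nonincreasing and right-continuous in
`h` (Ellis V.7.3 (b), (c)), so dominated convergence with the bound `u(0,·;h₀)` applies).
[cite: Ellis2006, Lemma V.7.3 (b), (c) and proof of Lemma V.7.4 (a)] -/
theorem tendsto_tsum_plusTruncated_nhdsWithin_Ici {β : ℝ} (hβ : 0 ≤ β) {h₀ : ℝ} (hh₀ : 0 ≤ h₀)
    (hs : Summable fun z : Site d => plusCorr d β h₀ ({0} ∆ {z}) - plusCorr d β h₀ {0} * plusCorr d β h₀ {z}) :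
    Tendsto (fun h => ∑' z : Site d, (plusCorr d β h ({0} ∆ {z}) - plusCorr d β h {0} * plusCorr d β h {z}))
      (𝓝[Ici h₀] h₀) (𝓝 (∑' z : Site d, (plusCorr d β h₀ ({0} ∆ {z}) - plusCorr d β h₀ {0} * plusCorr d β h₀ {z}))) := by
  refine tendsto_tsum_of_dominated_convergence hs (fun z => plusTruncated_continuousWithinAt_Ici_field hβ 0 z hh₀) ?_
  filter_upwards [self_mem_nhdsWithin] with h hh
  intro z
  rw [Real.norm_eq_abs, abs_of_nonneg (plusTruncated_nonneg hβ h 0 z)]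
  exact plusTruncated_antitoneOn_field hβ 0 z (mem_Ici.2 hh₀) (mem_Ici.2 (hh₀.trans hh)) hh

/-- **`σ²(β,h) → ∞` as `h ↓ h₀` when `σ²(β,h₀) = ∞`** (`β > 0`, `h₀ ≥ 0`; for `h > h₀ ≥ 0` the sum converges by the
GHS bound `Σ_z u(0,z;h) ≤ 4/(βh)`, `summable_plusTruncated_of_pos_field`). [cite: Ellis2006, Lemma V.7.3 (c) and proof of Lemma V.7.4] -/
theorem tendsto_tsum_plusTruncated_atTop_of_not_summable {β : ℝ} (hβ : 0 < β) {h₀ : ℝ} (hh₀ : 0 ≤ h₀)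
    (hs : ¬ Summable fun z : Site d => plusCorr d β h₀ ({0} ∆ {z}) - plusCorr d β h₀ {0} * plusCorr d β h₀ {z}) :
    Tendsto (fun h => ∑' z : Site d, (plusCorr d β h ({0} ∆ {z}) - plusCorr d β h {0} * plusCorr d β h {z}))
      (𝓝[>] h₀) atTop := by
  classical
  refine tendsto_atTop.2 fun M => ?_
  have hbig : ∃ F : Finset (Site d), M + 1 ≤
      ∑ y ∈ F, (plusCorr d β h₀ ({0} ∆ {y}) - plusCorr d β h₀ {0} * plusCorr d β h₀ {y}) := by
    by_contra hcon
    refine hs (summable_of_sum_le (c := M + 1) (fun z => plusTruncated_nonneg hβ.le h₀ 0 z) fun F => ?_)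
    by_contra hF
    exact hcon ⟨F, (not_le.1 hF).le⟩
  obtain ⟨F, hF⟩ := hbig
  have hlimF : Tendsto (fun h => ∑ y ∈ F, (plusCorr d β h ({0} ∆ {y}) - plusCorr d β h {0} * plusCorr d β h {y}))
      (𝓝[>] h₀) (𝓝 (∑ y ∈ F, (plusCorr d β h₀ ({0} ∆ {y}) - plusCorr d β h₀ {0} * plusCorr d β h₀ {y}))) :=
    tendsto_finsetSum _ fun y _ =>
      ((plusTruncated_continuousWithinAt_Ici_field hβ.le 0 y hh₀).tendsto).mono_left
        (nhdsWithin_mono _ Ioi_subset_Ici_self)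
  have hM : M < ∑ y ∈ F, (plusCorr d β h₀ ({0} ∆ {y}) - plusCorr d β h₀ {0} * plusCorr d β h₀ {y}) := by linarith
  filter_upwards [(tendsto_order.1 hlimF).1 M hM, self_mem_nhdsWithin] with h hM' hh
  have hpos : 0 < h := hh₀.trans_lt hh
  exact (hM'.trans_le ((summable_plusTruncated_of_pos_field hβ hpos).sum_le_tsum F fun z _ =>
    plusTruncated_nonneg hβ.le h 0 z)).le

end IsingSusceptibility

end Summit.CriticalPhenomena.PercolationContinuityZ3.Theorems.FK

end
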